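import Summits.Langlands.Langlands.Theorems.ParityBlindBianchiTwoAdicBianchiProModularityLevelSqueezeDefsLoci
import Summits.Langlands.Langlands.Theorems.ParityBlindBianchiTwoAdicBianchiProModularityLevelSqueezeArtinTypePoint
import HarnessLib

/-!
# Line `dimension-squeeze` (crux `TwoAdicBianchiProModularityLevel`, stmt-Langlands-15110): the Artin point is a
# point of the v3 type locus `V(typeIdealD)`

v3 companion of the landed `…SqueezeArtinTypePoint.lean` (p138885, GAL stub-worker of lead c14): the Artin point
`x_σ = emb ∘ φ_σ` also kills the DECOMPOSITION-trace generators of `typeIdealD` (traces are conjugation invariant on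
ALL of `Γ_K`, `Matrix.trace_units_conj'`), so it is a point of `V(typeIdealD)` and the v3 type locus
`R ⧸ locusOf typeIdealD` is non-zero.  Registered sub-goal `squeeze_exists_artinTypePointD`; first lemma of the v3
Galois stub `stub_galoisDomain` and the point through which the v3 `stub_zariskiReadout` factors.
[cite: Mazur1997Deformation, §20 Prop. 2] [cite: KisinModuli2009, §2.3]
-/

noncomputable section

set_option linter.dupNamespace false -- `Summit.Langlands.Langlands` is the mandated namespace (D-0017)

open scoped NumberField MatrixGroups
open Polynomial IsDedekindDomain Field
open Literature.NumberTheory.GaloisRepresentations Literature.NumberTheory.Automorphic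

namespace Summit.Langlands.Langlands.Cruxes.TwoAdicBianchiProModularityLevel.DimensionSqueeze

namespace Model

variable {K : Type} [Field K] [NumberField K] {σ : FramedGaloisRep K (PadicAlgCl 2) 2} (M : Model σ)
  {S₀ : Finset ℕ} {h0 : (0 : ℕ) ∉ S₀} {h2 : 2 ∈ S₀}
  {hunr : ∀ v ∉ badSet K S₀, Deformation.IsUnramifiedAt v M.residual}

/-- **A point of `R` at which `ρ^univ` becomes strictly equivalent to `σ_𝒪` kills `typeIdealD`**: it kills
`typeIdeal` (`Model.typeIdeal_le_ker`) and every decomposition-trace generator (`Matrix.trace_units_conj'`).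
[folklore] -/
theorem typeIdealD_le_ker (𝓡 : PolarizedDeformationRing (M.datum S₀ h0 h2 hunr)) (φ : 𝓡.R →ₐ[M.𝒪] M.𝒪)
    (hφ : Deformation.IsStrictEquiv (algebraMap M.𝒪 M.k)
      ((Matrix.GeneralLinearGroup.map (φ : 𝓡.R →+* M.𝒪)).comp 𝓡.ρ) M.σ𝒪) :
    M.typeIdealD 𝓡 ≤ RingHom.ker (M.emb.comp (φ : 𝓡.R →+* M.𝒪)) := by
  refine sup_le (M.typeIdeal_le_ker 𝓡 φ hφ) ?_
  obtain ⟨P, -, hP⟩ := hφ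
  have hcomm : ∀ y : M.𝒪, (φ : 𝓡.R →+* M.𝒪) (algebraMap M.𝒪 𝓡.R y) = y := fun y => by simp
  have hval : ∀ g : absoluteGaloisGroup K,
      (φ : 𝓡.R →+* M.𝒪).mapMatrix ((𝓡.ρ g : GL (Fin 2) 𝓡.R) : Matrix (Fin 2) (Fin 2) 𝓡.R) =
        ((P⁻¹ : GL (Fin 2) M.𝒪) : Matrix (Fin 2) (Fin 2) M.𝒪) *
          ((M.σ𝒪 g : GL (Fin 2) M.𝒪) : Matrix (Fin 2) (Fin 2) M.𝒪) *
            ((P : GL (Fin 2) M.𝒪) : Matrix (Fin 2) (Fin 2) M.𝒪) := by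
    intro g
    have h1 : ((Matrix.GeneralLinearGroup.map (φ : 𝓡.R →+* M.𝒪)).comp 𝓡.ρ) g = P⁻¹ * M.σ𝒪 g * P := by
      rw [hP g]; group
    rw [MonoidHom.comp_apply] at h1
    ext i j
    rw [RingHom.mapMatrix_apply, Matrix.map_apply, ← Matrix.GeneralLinearGroup.map_apply, h1,
      Units.val_mul, Units.val_mul]
  rw [Ideal.span_le]
  rintro x ⟨v, 𝔓, g, -, -, -, -, -, rfl⟩
  rw [SetLike.mem_coe, RingHom.mem_ker, RingHom.comp_apply]
  suffices h : (φ : 𝓡.R →+* M.𝒪) _ = 0 by rw [h, map_zero]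
  rw [map_sub, AddMonoidHom.map_trace (φ : 𝓡.R →+* M.𝒪), ← RingHom.mapMatrix_apply, hval,
    Matrix.trace_units_conj', hcomm, sub_self]

end Model

/-- REGISTERED SUB-GOAL `squeeze_exists_artinTypePointD` (v3; first lemma of `stub_galoisDomain`, and the point
through which `stub_zariskiReadout` factors): **the Artin point `x_σ` exists and is a point of `V(typeIdealD)`.**
[cite: Mazur1997Deformation, §20 Prop. 2] -/
theorem squeeze_exists_artinTypePointD : ∀ (K : Type) [Field K] [NumberField K]
    (σ : FramedGaloisRep K (PadicAlgCl 2) 2) (S₀ : Finset ℕ) (h0 : (0 : ℕ) ∉ S₀) (h2 : 2 ∈ S₀),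
    (∀ v : HeightOneSpectrum (𝓞 K), (∀ ℓ ∈ S₀, ((ℓ : ℕ) : 𝓞 K) ∉ v.asIdeal) → σ.IsUnramifiedAt v) →
    ∀ (M : Model σ) (hunr : ∀ v ∉ badSet K S₀, Deformation.IsUnramifiedAt v M.residual)
      (𝓡 : PolarizedDeformationRing (M.datum S₀ h0 h2 hunr)),
    ∃ φ : 𝓡.R →ₐ[M.𝒪] M.𝒪,
      Deformation.IsStrictEquiv (algebraMap M.𝒪 M.k)
        ((Matrix.GeneralLinearGroup.map (φ : 𝓡.R →+* M.𝒪)).comp 𝓡.ρ) M.σ𝒪 ∧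
      M.emb.comp (φ : 𝓡.R →+* M.𝒪) ∈ M.pointsOf 𝓡 (M.typeIdealD 𝓡) := by
  intro K _ _ σ S₀ h0 h2 hσ M hunr 𝓡
  obtain ⟨φ, hφ, -⟩ :=
    𝓡.universal M.𝒪 (Algebra.ofId M.𝒪 M.k) M.residue_surjective M.σ𝒪 (M.isDeformation_σ𝒪 hσ)
  exact ⟨φ, hφ, RingHom.ext fun y => by simp, M.typeIdealD_le_ker 𝓡 φ hφ⟩

/-- Consequence: **the v3 type locus is non-zero** (`locusOf typeIdealD ≠ ⊤`). [folklore] -/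
theorem squeeze_locusOfD_ne_top : ∀ (K : Type) [Field K] [NumberField K]
    (σ : FramedGaloisRep K (PadicAlgCl 2) 2) (S₀ : Finset ℕ) (h0 : (0 : ℕ) ∉ S₀) (h2 : 2 ∈ S₀),
    (∀ v : HeightOneSpectrum (𝓞 K), (∀ ℓ ∈ S₀, ((ℓ : ℕ) : 𝓞 K) ∉ v.asIdeal) → σ.IsUnramifiedAt v) →
    ∀ (M : Model σ) (hunr : ∀ v ∉ badSet K S₀, Deformation.IsUnramifiedAt v M.residual)
      (𝓡 : PolarizedDeformationRing (M.datum S₀ h0 h2 hunr)),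
    M.locusOf 𝓡 (M.typeIdealD 𝓡) ≠ ⊤ := by
  intro K _ _ σ S₀ h0 h2 hσ M hunr 𝓡 htop
  obtain ⟨φ, -, hφ⟩ := squeeze_exists_artinTypePointD K σ S₀ h0 h2 hσ M hunr 𝓡
  have hle : M.locusOf 𝓡 (M.typeIdealD 𝓡) ≤ RingHom.ker (M.emb.comp (φ : 𝓡.R →+* M.𝒪)) := iInf₂_le _ hφ
  rw [htop, top_le_iff] at hle
  exact RingHom.ker_ne_top _ hle

end Summit.Langlands.Langlands.Cruxes.TwoAdicBianchiProModularityLevel.DimensionSqueeze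

end
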